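import Mathlib
import Literature.NumberTheory.Transcendental.KZCubeRationalMoves

/-!
# Polynomials with zero cube integral are Kontsevich–Zagier relations

For the crux `TateFamilyKernel` (stmt-KontsevichZagierPeriods-9130, route `InverseLandau`): at the
Tate point `ϖ = 0` every fibre (and every `ϖ`-jet) of a Tate family `P/Q` is a POLYNOMIAL in the cube
variables with zero cube integral. This file proves that such a fibre is a relation of the calculus:
`∫_{[0,1]^M} p = 0 ⟹ [[0,1]^M, p] ∈ KZ.relations` (`KZ.RFun.poly_rep_mem_relations_of_integral_eq_zero`),
by induction on `M` — one Stokes move along the last variable with the polynomial primitive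
`∫₀^{x_M} p`, whose two faces differ by a polynomial in `M − 1` variables of zero integral (soundness of
the move), down to `M = 0` where the integrand is the constant `0`.
-/

noncomputable section

open MeasureTheory Set MvPolynomial
open Literature.NumberTheory.Transcendental

namespace Literature.NumberTheory.Transcendental.KZ

variable {M : ℕ}

/-- Every polynomial has a polynomial primitive along a given variable:
`∃ G, ∂ᵢ G = p` (integrate each monomial). [folklore] -/
theorem exists_pderiv_eq (i : Fin M) (p : MvPolynomial (Fin M) ℚ) :
    ∃ G : MvPolynomial (Fin M) ℚ, pderiv i G = p := by
  induction p using MvPolynomial.induction_on' with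
  | monomial s a =>
    refine ⟨monomial (s + Finsupp.single i 1) (a / ((s i : ℚ) + 1)), ?_⟩
    rw [pderiv_monomial]
    simp only [add_tsub_cancel_right, Finsupp.coe_add, Pi.add_apply, Finsupp.single_eq_same,
      Nat.cast_add, Nat.cast_one]
    congr 1
    have : ((s i : ℚ) + 1) ≠ 0 := by positivity
    field_simp
  | add p q hp hq =>
    obtain ⟨G, hG⟩ := hp
    obtain ⟨H, hH⟩ := hq
    exact ⟨G + H, by rw [map_add, hG, hH]⟩

namespace RFun

/-- The cube `[0,1]⁰` is the one-point space. [folklore] -/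
theorem cube_zero_eq_univ : KZ.cube 0 = (Set.univ : Set (Fin 0 → ℝ)) := by
  ext x
  simp [KZ.cube]

/-- The value of `[[0,1]^M, p]` is `∫_{[0,1]^M} p`. [folklore] -/
theorem value_poly_rep (p : MvPolynomial (Fin M) ℚ) :
    (poly p).rep.value = ∫ x in KZ.cube M, (aeval x p : ℝ) := by
  rw [(poly p).isTameCube_rep.value_eq]
  refine setIntegral_congr_fun KZ.measurableSet_cube fun x _ => ?_
  simp

/-- **A polynomial with zero cube integral represents a relation**:
`∫_{[0,1]^M} p = 0 ⟹ [[0,1]^M, p] ∈ KZ.relations`. Induction on `M`: one Stokes move along the last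
variable with a polynomial primitive (`KZ.RFun.stokes`), whose faces differ by a polynomial of zero
integral in one variable less (soundness `KZ.relations_le_ker_eval_holds`); for `M = 0` the integrand
is the constant `0`. [cite: KontsevichZagier2001, §1.2] -/
theorem poly_rep_mem_relations_of_integral_eq_zero :
    ∀ (M : ℕ) (p : MvPolynomial (Fin M) ℚ),
      (∫ x in KZ.cube M, (aeval x p : ℝ)) = 0 → KZ.of (poly p).rep ∈ KZ.relations
  | 0, p, hp => by
    refine rel_of_eqOn_zero fun x _ => ?_
    rw [fn_poly]
    have hconst : (fun y : Fin 0 → ℝ => (aeval y p : ℝ)) = fun _ => aeval x p :=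
      funext fun y => by rw [Subsingleton.elim y x]
    have : (∫ y in KZ.cube 0, (aeval y p : ℝ)) = aeval x p := by
      rw [hconst, setIntegral_const, KZ.volume_real_cube, one_smul]
    rw [← this]
    exact hp
  | M + 1, p, hp => by
    obtain ⟨G, hG⟩ := exists_pderiv_eq (Fin.last M) p
    set T : RFun (M + 1) := poly G with hT
    -- `∂_last T` is `p` on the cube
    have hdl : ∀ x ∈ KZ.cube (M + 1), T.dlast.fn x = aeval x p := fun x _ => by
      simp [hT, dlast, poly, fn, hG]
    have e1 : KZ.of (poly p).rep - KZ.of T.dlast.rep ∈ KZ.relations :=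
      rel_of_eqOn fun x hx => by rw [fn_poly, hdl x hx]
    have hst := stokes T
    set F1 := T.face 1 ⟨zero_le_one, le_rfl⟩ with hF1
    set F0 := T.face 0 ⟨le_rfl, zero_le_one⟩ with hF0
    -- the face difference is the polynomial `G(·,1) − G(·,0)` in `M` variables
    set g : MvPolynomial (Fin M) ℚ := bind₁ (faceSubst M 1) G - bind₁ (faceSubst M 0) G with hg
    have hgfn : ∀ x : Fin M → ℝ, (aeval x g : ℝ) = F1.fn x - F0.fn x := fun x => by
      rw [hg, map_sub, aeval_bind₁, aeval_bind₁, aeval_faceSubst, aeval_faceSubst, hF1, hF0,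
        fn_face, fn_face, hT, fn_poly, fn_poly]
    have e2 : KZ.of F1.rep - KZ.of F0.rep - KZ.of (poly g).rep ∈ KZ.relations := by
      have h := rel_sub F1 F0
      have h' : KZ.of (F1.sub F0).rep - KZ.of (poly g).rep ∈ KZ.relations :=
        rel_of_eqOn fun x hx => by rw [fn_sub hx, fn_poly, hgfn]
      have : KZ.of F1.rep - KZ.of F0.rep - KZ.of (poly g).rep =
          (KZ.of (F1.sub F0).rep - KZ.of (poly g).rep) -
            (KZ.of (F1.sub F0).rep - (KZ.of F1.rep - KZ.of F0.rep)) := by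
        abel
      rw [this]
      exact KZ.relations.sub_mem h' h
    have hchain : KZ.of (poly p).rep - KZ.of (poly g).rep ∈ KZ.relations := by
      have : KZ.of (poly p).rep - KZ.of (poly g).rep =
          (KZ.of (poly p).rep - KZ.of T.dlast.rep) +
            (KZ.of T.dlast.rep - (KZ.of F1.rep - KZ.of F0.rep)) +
            (KZ.of F1.rep - KZ.of F0.rep - KZ.of (poly g).rep) := by abel
      rw [this]
      exact KZ.relations.add_mem (KZ.relations.add_mem e1 hst) e2
    -- … and it has zero integral, by soundness of the moves
    have hint : (∫ x in KZ.cube M, (aeval x g : ℝ)) = 0 := by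
      have hsound : KZ.eval (KZ.of (poly p).rep - KZ.of (poly g).rep) = 0 :=
        KZ.relations_le_ker_eval_holds hchain
      rw [map_sub, KZ.eval_of, KZ.eval_of, sub_eq_zero, value_poly_rep, value_poly_rep, hp] at hsound
      exact hsound.symm
    have ih := poly_rep_mem_relations_of_integral_eq_zero M g hint
    have : KZ.of (poly p).rep = (KZ.of (poly p).rep - KZ.of (poly g).rep) + KZ.of (poly g).rep := by
      abel
    rw [this]
    exact KZ.relations.add_mem hchain ih

end RFun

end Literature.NumberTheory.Transcendental.KZ
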